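import Literature.Probability.TransportMaps.DobrushinCouplingCompact
import HarnessLib

/-!
# Resampling-INVARIANT Dobrushin couplings (the fixed point `T Q = Q` of Presutti's proof of
# Thm. 3.2.2.1) for compact spins with FELLER one-site couplings, and the consequence: the
# conclusion of Theorem 3.2.2.1 as an identity for EVERY measurable cost at once

[topic Probability/TransportMaps]

E. Presutti, *Scaling Limits in Statistical Mechanics and Microstructures in Continuum Mechanics*
(Springer TMP 2009), §3.2.2 [Presutti2009]. In the printed (finite single-spin space) proof of
Theorem 3.2.2.1 the coupling is a Cesàro limit `Q` of the orbit of the averaged resampling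
operator `T = n⁻¹ Σᵢ Tᵢ` (3.2.2.5)–(3.2.2.7), and «recall that the space is finite» gives the
FIXED-POINT IDENTITY `T Q = Q`, from which (3.2.2.8) reads, for every site `i`,
`Σ d(ωᵢ, ω'ᵢ) Q(ω, ω') = Σ [Σ d(ωᵢ, ω'ᵢ) q_{i,ω,ω'}(ωᵢ, ω'ᵢ)] Q(ω, ω')` — an EQUALITY, valid for any
cost `d` whatsoever. `DobrushinCouplingCompact.lean` proves the theorem for a compact metric spin
space by the orbit inequality instead (no fixed point), which costs the hypothesis that the site
costs `dᵢ` and the bounds `Kᵢ` be bounded CONTINUOUS (weak limits). This file recovers the printed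
fixed point for compact spins when the one-site couplings `qᵢ(ω, ω')` are FELLER (weakly continuous
in `(ω, ω')` — e.g. the explicit maximal coupling of two one-site laws with continuous positive
densities, or any continuous selection), and draws the consequence:

* `exists_invariant_isCoupling` — for `OneSiteKernels μ μ' γ γ' q` (resampling-invariant `μ, μ'`,
  Markov one-site kernels, measurable one-site couplings) with Feller `qᵢ`, there is a coupling
  `Q` of `μ, μ'` with `T Q = Q` (`avgResample q Q = Q`). Proof: Cesàro means of the orbit of
  `μ ⊗ μ'` (as in `DobrushinCouplingCompact`), a weakly convergent subsequence (Prokhorov), and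
  `T(Cesàro_k) − Cesàro_k = (k+1)⁻¹ (P_{k+1} − P₀) → 0` together with the weak continuity of
  `P ↦ ∫ F dT(P)` for bounded continuous `F` (`continuous_integral_updatePair`), so the limit is
  `T`-invariant;
* `lintegral_coord_eq_of_invariant` — for a `T`-invariant probability measure `Q` and EVERY bounded
  measurable cost `c : S × S → ℝ≥0∞`: `∫ c(ωᵢ, ω'ᵢ) dQ = ∫ (∫ c dqᵢ(ω, ω')) dQ(ω, ω')` (the printed
  (3.2.2.8) as an identity: `n·A = (n−1)·A + B`);
* ★ `Presutti2009_thm_3_2_2_1_feller` — hence ONE coupling `Q` of `μ, μ'` such that for every site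
  `i`, every bounded measurable cost `cᵢ` and every measurable bound `Kᵢ` with
  `∫ cᵢ dqᵢ(ω, ω') ≤ Kᵢ(ω, ω')` pointwise, `∫ cᵢ(ωᵢ, ω'ᵢ) dQ ≤ ∫ Kᵢ dQ` — Theorem 3.2.2.1 with NO
  continuity of costs or bounds; in particular for the DISCRETE cost `𝟙{s ≠ s'}` (total-variation
  currency), which is the setting of the Dobrushin–Pechersky criterion with bad sets (Conache,
  Kondratiev, Kozitsky, Pasurek, arXiv:1501.00673, Lemmas 3.4–3.6: the same reconstruction map
  `R_ℓ` and the role of MEASURABLE/regular couplings), and `Presutti2009_cor_3_2_2_2_feller`.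

Scope (honest): finite index set, compact metric spins (for Prokhorov), Feller coupling kernels as a
HYPOTHESIS (this file does not construct them). Nothing model-specific.
-- TODO(general form): countable index sets; non-compact spins (Dobrushin–Pechersky work with the
-- topology of local setwise convergence instead of weak compactness).

## References
* E. Presutti, *Scaling Limits in Statistical Mechanics and Microstructures in Continuum Mechanics*,
  Springer 2009, §3.2.2 Thm. 3.2.2.1, proof (3.2.2.4)–(3.2.2.8). [Presutti2009]
* D. Conache, Yu. Kondratiev, Yu. Kozitsky, T. Pasurek, *Gibbs Fields: Uniqueness and Decay of
  Correlations. Revisiting Dobrushin and Pechersky*, arXiv:1501.00673 (2015), §3.1 (16),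
  Lemmas 3.4–3.5.
* R. L. Dobrushin, Theory Probab. Appl. 15 (1970) 458–486.
-/

noncomputable section

open MeasureTheory ProbabilityTheory Filter Function Finset
open scoped ENNReal NNReal Topology BoundedContinuousFunction

namespace Literature.Probability.TransportMaps

namespace DobrushinCouplingInvariant

open Literature.MeasureTheory.OptimalTransport (IsCoupling)
open Literature.Probability.TransportMaps.DobrushinCouplingCompact

variable {ι : Type*} [Fintype ι] [DecidableEq ι]
variable {S : Type*} [MeasurableSpace S]

/-! ### Linearity of the resampling operators -/

omit [Fintype ι] in
/-- `Tᵢ 0 = 0`. [cite: Presutti2009, §3.2.2 (3.2.2.4)] -/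
theorem resample_zero (q : Kernel ((ι → S) × (ι → S)) (S × S)) (i : ι) :
    resample q i (0 : Measure ((ι → S) × (ι → S))) = 0 := by
  simp [resample]

omit [Fintype ι] in
/-- `Tᵢ` is additive in the measure. [cite: Presutti2009, §3.2.2 (3.2.2.4)] -/
theorem resample_add (q : Kernel ((ι → S) × (ι → S)) (S × S)) [IsMarkovKernel q] (i : ι)
    (P P' : Measure ((ι → S) × (ι → S))) [SFinite P] [SFinite P'] :
    resample q i (P + P') = resample q i P + resample q i P' := by
  rw [resample, resample, resample, Measure.compProd_add_left, Measure.map_add _ _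
    (measurable_updatePair i)]

omit [Fintype ι] in
/-- `Tᵢ` is homogeneous in the measure. [cite: Presutti2009, §3.2.2 (3.2.2.4)] -/
theorem resample_smul (q : Kernel ((ι → S) × (ι → S)) (S × S)) [IsMarkovKernel q] (i : ι)
    (a : ℝ≥0∞) (P : Measure ((ι → S) × (ι → S))) [SFinite P] [SFinite (a • P)] :
    resample q i (a • P) = a • resample q i P := by
  rw [resample, resample, Measure.compProd_smul_left, Measure.map_smul]

/-- `T` is additive. [cite: Presutti2009, §3.2.2 (3.2.2.5)] -/
theorem avgResample_add (q : ι → Kernel ((ι → S) × (ι → S)) (S × S)) [∀ i, IsMarkovKernel (q i)]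
    (P P' : Measure ((ι → S) × (ι → S))) [SFinite P] [SFinite P'] :
    avgResample q (P + P') = avgResample q P + avgResample q P' := by
  simp only [avgResample, resample_add, sum_add_distrib, smul_add]

/-- `T` is homogeneous. [cite: Presutti2009, §3.2.2 (3.2.2.5)] -/
theorem avgResample_smul (q : ι → Kernel ((ι → S) × (ι → S)) (S × S)) [∀ i, IsMarkovKernel (q i)]
    (a : ℝ≥0∞) (P : Measure ((ι → S) × (ι → S))) [SFinite P] [SFinite (a • P)] :
    avgResample q (a • P) = a • avgResample q P := by
  simp only [avgResample, resample_smul, ← Finset.smul_sum, smul_smul, mul_comm a]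

/-- `T` of a finite sum of probability measures. [cite: Presutti2009, §3.2.2 (3.2.2.5)] -/
theorem avgResample_sum (q : ι → Kernel ((ι → S) × (ι → S)) (S × S)) [∀ i, IsMarkovKernel (q i)]
    {κ : Type*} (t : Finset κ) (P : κ → Measure ((ι → S) × (ι → S)))
    [∀ k, IsProbabilityMeasure (P k)] :
    avgResample q (∑ k ∈ t, P k) = ∑ k ∈ t, avgResample q (P k) := by
  classical
  induction t using Finset.induction_on with
  | empty =>
    simp [avgResample, resample_zero]
  | insert k t hk ih =>
    haveI : SFinite (∑ k ∈ t, P k) := by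
      haveI : IsFiniteMeasure (∑ k ∈ t, P k) := by infer_instance
      infer_instance
    rw [sum_insert hk, sum_insert hk, avgResample_add, ih]

/-! ### The Cesàro step: `(k+1)·T(Q_k) + P₀ = (k+1)·Q_k + P_{k+1}` -/

section Cesaro

variable (q : ι → Kernel ((ι → S) × (ι → S)) (S × S)) [Nonempty ι] [∀ i, IsMarkovKernel (q i)]

/-- The telescoping identity behind «Q_k converges … to a limit Q with T Q = Q»:
`(k+1)·T(Q_k) + P₀ = (k+1)·Q_k + P_{k+1}` as measures.
[cite: Presutti2009, §3.2.2 (3.2.2.6)–(3.2.2.7)] -/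
theorem smul_avgResample_cesaro_add (P₀ : ProbabilityMeasure ((ι → S) × (ι → S))) (k : ℕ) :
    ((k + 1 : ℕ) : ℝ≥0∞) • avgResample q (cesaro q P₀ k : Measure ((ι → S) × (ι → S))) +
        (P₀ : Measure ((ι → S) × (ι → S))) =
      ((k + 1 : ℕ) : ℝ≥0∞) • (cesaro q P₀ k : Measure ((ι → S) × (ι → S))) +
        (orbit q P₀ (k + 1) : Measure ((ι → S) × (ι → S))) := by
  have hk : ((k + 1 : ℕ) : ℝ≥0∞) ≠ 0 := by exact_mod_cast Nat.succ_ne_zero k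
  have hk' : ((k + 1 : ℕ) : ℝ≥0∞) ≠ ⊤ := ENNReal.natCast_ne_top _
  -- `(k+1)·Q_k = Σ_{h ≤ k} P_h`
  have hces : ((k + 1 : ℕ) : ℝ≥0∞) • (cesaro q P₀ k : Measure ((ι → S) × (ι → S))) =
      ∑ h ∈ range (k + 1), (orbit q P₀ h : Measure ((ι → S) × (ι → S))) := by
    rw [coe_cesaro, smul_smul, ENNReal.mul_inv_cancel hk hk', one_smul]
  -- `T` is linear, and `T P_h = P_{h+1}`
  have hT : ((k + 1 : ℕ) : ℝ≥0∞) • avgResample q (cesaro q P₀ k : Measure ((ι → S) × (ι → S))) =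
      ∑ h ∈ range (k + 1), (orbit q P₀ (h + 1) : Measure ((ι → S) × (ι → S))) := by
    haveI : SFinite (((k + 1 : ℕ) : ℝ≥0∞) •
        (cesaro q P₀ k : Measure ((ι → S) × (ι → S)))) := by
      rw [hces]
      haveI : IsFiniteMeasure (∑ h ∈ range (k + 1),
          (orbit q P₀ h : Measure ((ι → S) × (ι → S)))) := by infer_instance
      infer_instance
    rw [← avgResample_smul, hces, avgResample_sum]
    simp_rw [coe_orbit_succ]
  rw [hT, hces]
  have h' := Finset.sum_range_succ' (fun h => (orbit q P₀ h : Measure ((ι → S) × (ι → S)))) (k + 1)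
  rw [orbit_zero] at h'
  rw [← h', Finset.sum_range_succ]

/-- Integrated form: `∫F dT(Q_k) + (k+1)⁻¹ ∫F dP₀ = ∫F dQ_k + (k+1)⁻¹ ∫F dP_{k+1}`.
[cite: Presutti2009, §3.2.2 (3.2.2.6)–(3.2.2.7)] -/
theorem lintegral_avgResample_cesaro_add (P₀ : ProbabilityMeasure ((ι → S) × (ι → S))) (k : ℕ)
    (F : (ι → S) × (ι → S) → ℝ≥0∞) :
    ∫⁻ x, F x ∂(avgResample q (cesaro q P₀ k : Measure ((ι → S) × (ι → S)))) +
        ((k + 1 : ℕ) : ℝ≥0∞)⁻¹ * ∫⁻ x, F x ∂(P₀ : Measure ((ι → S) × (ι → S))) =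
      ∫⁻ x, F x ∂(cesaro q P₀ k : Measure ((ι → S) × (ι → S))) +
        ((k + 1 : ℕ) : ℝ≥0∞)⁻¹ * ∫⁻ x, F x ∂(orbit q P₀ (k + 1) : Measure ((ι → S) × (ι → S))) := by
  have hk : ((k + 1 : ℕ) : ℝ≥0∞) ≠ 0 := by exact_mod_cast Nat.succ_ne_zero k
  have hk' : ((k + 1 : ℕ) : ℝ≥0∞) ≠ ⊤ := ENNReal.natCast_ne_top _
  have h := congrArg (fun m : Measure ((ι → S) × (ι → S)) => ((k + 1 : ℕ) : ℝ≥0∞)⁻¹ * ∫⁻ x, F x ∂m)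
    (smul_avgResample_cesaro_add q P₀ k)
  simp only [lintegral_add_measure, lintegral_smul_measure, smul_eq_mul, mul_add, ← mul_assoc,
    ENNReal.inv_mul_cancel hk hk', one_mul] at h
  exact h

end Cesaro

/-! ### Feller couplings: `P ↦ ∫ F dTᵢ(P)` integrates a bounded CONTINUOUS function of the pair -/

section Feller

variable [MetricSpace S] [CompactSpace S] [BorelSpace S]

omit [Fintype ι] [MeasurableSpace S] [BorelSpace S] in
/-- For a bounded continuous `F` on pairs of configurations, the partial map
`x ↦ (s ↦ F(x with i-th coordinates replaced by s))` is continuous into the bounded continuous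
functions of `s` (uniform continuity on the compact product). [cite: Presutti2009, §3.2.2 (3.2.2.4)] -/
theorem continuous_compUpdatePair [Fintype ι] (i : ι) (F : ((ι → S) × (ι → S)) →ᵇ ℝ) :
    Continuous fun x : (ι → S) × (ι → S) =>
      F.compContinuous (⟨fun s : S × S => updatePair i (x, s), by unfold updatePair; fun_prop⟩) := by
  have hcont : Continuous fun p : ((ι → S) × (ι → S)) × (S × S) => F (updatePair i p) :=
    F.continuous.comp (by unfold updatePair; fun_prop)
  have huc := CompactSpace.uniformContinuous_of_continuous hcont
  rw [Metric.uniformContinuous_iff] at huc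
  rw [Metric.continuous_iff]
  intro x ε hε
  obtain ⟨δ, hδ, hδε⟩ := huc (ε / 2) (half_pos hε)
  refine ⟨δ, hδ, fun y hy => ?_⟩
  refine lt_of_le_of_lt ((BoundedContinuousFunction.dist_le (half_pos hε).le).2 fun s => ?_)
    (half_lt_self hε)
  refine (hδε ?_).le
  simpa [Prod.dist_eq, hy] using hy

omit [Fintype ι] in
/-- **Feller property of `Tᵢ` at the level of integrands.** If the one-site coupling kernel `qᵢ`
is Feller (`x ↦ ∫ g dqᵢ(x)` continuous for bounded continuous `g`), then for every bounded
continuous `F` on pairs of configurations the function `x ↦ ∫ F(x[i ↦ s]) dqᵢ(x)(s)` is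
continuous. [cite: Presutti2009, §3.2.2 (3.2.2.4)] -/
theorem continuous_integral_updatePair [Fintype ι] (q : Kernel ((ι → S) × (ι → S)) (S × S))
    [IsMarkovKernel q] (hq : ∀ g : (S × S) →ᵇ ℝ, Continuous fun x => ∫ s, g s ∂(q x)) (i : ι)
    (F : ((ι → S) × (ι → S)) →ᵇ ℝ) :
    Continuous fun x : (ι → S) × (ι → S) => ∫ s, F (updatePair i (x, s)) ∂(q x) := by
  let Φ : ((ι → S) × (ι → S)) → ((S × S) →ᵇ ℝ) := fun x =>
    F.compContinuous (⟨fun s : S × S => updatePair i (x, s), by unfold updatePair; fun_prop⟩)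
  have hΦ : Continuous Φ := continuous_compUpdatePair i F
  have hΦapply : ∀ x s, Φ x s = F (updatePair i (x, s)) := fun x s => rfl
  refine continuous_iff_continuousAt.2 fun x₀ => ?_
  -- split `∫ Φ x dq_x = ∫ (Φ x − Φ x₀) dq_x + ∫ Φ x₀ dq_x`
  have key : ∀ x, ∫ s, F (updatePair i (x, s)) ∂(q x) =
      (∫ s, (Φ x - Φ x₀) s ∂(q x)) + ∫ s, Φ x₀ s ∂(q x) := fun x => by
    rw [← integral_add ((Φ x - Φ x₀).integrable _) ((Φ x₀).integrable _)]
    refine integral_congr_ae (ae_of_all _ fun s => ?_)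
    simp [hΦapply]
  have hlim : Tendsto (fun x => (∫ s, (Φ x - Φ x₀) s ∂(q x)) + ∫ s, Φ x₀ s ∂(q x)) (𝓝 x₀)
      (𝓝 (0 + ∫ s, Φ x₀ s ∂(q x₀))) := by
    refine Tendsto.add ?_ ((hq (Φ x₀)).tendsto x₀)
    refine squeeze_zero_norm (fun x => (Φ x - Φ x₀).norm_integral_le_norm (q x)) ?_
    have h1 : Tendsto (fun x => Φ x - Φ x₀) (𝓝 x₀) (𝓝 (Φ x₀ - Φ x₀)) :=
      (hΦ.tendsto x₀).sub tendsto_const_nhds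
    rw [sub_self] at h1
    exact tendsto_norm_zero.comp h1
  have h0 : ∫ s, F (updatePair i (x₀, s)) ∂(q x₀) = 0 + ∫ s, Φ x₀ s ∂(q x₀) := by
    rw [key x₀, sub_self]
    simp
  rw [ContinuousAt, h0]
  exact hlim.congr fun x => (key x).symm

omit [Fintype ι] in
/-- The same for `ℝ≥0`-valued bounded continuous integrands, packaged as a bounded continuous
function `Gᵢ` with `Gᵢ(x) = ∫ F(x[i ↦ s]) dqᵢ(x)(s)` (as an `ℝ≥0∞`-valued integral).
[cite: Presutti2009, §3.2.2 (3.2.2.4)] -/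
theorem exists_bcf_lintegral_updatePair [Fintype ι] (q : Kernel ((ι → S) × (ι → S)) (S × S))
    [IsMarkovKernel q] (hq : ∀ g : (S × S) →ᵇ ℝ, Continuous fun x => ∫ s, g s ∂(q x)) (i : ι)
    (F : ((ι → S) × (ι → S)) →ᵇ ℝ≥0) :
    ∃ G : ((ι → S) × (ι → S)) →ᵇ ℝ≥0, ∀ x,
      (G x : ℝ≥0∞) = ∫⁻ s, (F (updatePair i (x, s)) : ℝ≥0∞) ∂(q x) := by
  -- the real-valued version of `F`
  let Fr : ((ι → S) × (ι → S)) →ᵇ ℝ :=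
    BoundedContinuousFunction.mkOfCompact ⟨fun x => (F x : ℝ), by fun_prop⟩
  have hFr : ∀ x, Fr x = (F x : ℝ) := fun x => rfl
  have hcont : Continuous fun x : (ι → S) × (ι → S) => ∫ s, Fr (updatePair i (x, s)) ∂(q x) :=
    continuous_integral_updatePair q hq i Fr
  have hnn : ∀ x : (ι → S) × (ι → S), 0 ≤ ∫ s, Fr (updatePair i (x, s)) ∂(q x) := fun x =>
    integral_nonneg fun s => by rw [hFr]; exact (F _).2
  refine ⟨BoundedContinuousFunction.mkOfCompact
      ⟨fun x => ⟨∫ s, Fr (updatePair i (x, s)) ∂(q x), hnn x⟩, hcont.subtype_mk hnn⟩, fun x => ?_⟩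
  -- `↑⟨∫ F, _⟩ = ENNReal.ofReal (∫ F) = ∫⁻ F`
  have hint : Integrable (fun s : S × S => ((F (updatePair i (x, s)) : ℝ≥0) : ℝ)) (q x) :=
    (F.compContinuous (⟨fun s : S × S => updatePair i (x, s), by unfold updatePair; fun_prop⟩)
      ).integrable_of_nnreal (q x)
  rw [lintegral_coe_eq_integral _ hint, ← ENNReal.ofReal_coe_nnreal]
  rfl

end Feller

/-! ### The invariant coupling (fixed point `T Q = Q`) -/

section Main

variable [MetricSpace S] [CompactSpace S] [BorelSpace S] [Nonempty ι]
variable {μ μ' : Measure (ι → S)} {γ γ' : ι → Kernel (ι → S) S}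
  {q : ι → Kernel ((ι → S) × (ι → S)) (S × S)}

omit [Nonempty ι] in
/-- `∫ F dT(P)` is the `P`-integral of the bounded continuous function `n⁻¹ Σᵢ Gᵢ`.
[cite: Presutti2009, §3.2.2 (3.2.2.5)] -/
theorem lintegral_avgResample_eq_sum_lintegral [∀ i, IsMarkovKernel (q i)]
    (F : ((ι → S) × (ι → S)) →ᵇ ℝ≥0) (G : ι → ((ι → S) × (ι → S)) →ᵇ ℝ≥0)
    (hG : ∀ i x, (G i x : ℝ≥0∞) = ∫⁻ s, (F (updatePair i (x, s)) : ℝ≥0∞) ∂(q i x))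
    (P : Measure ((ι → S) × (ι → S))) [IsProbabilityMeasure P] :
    ∫⁻ x, (F x : ℝ≥0∞) ∂(avgResample q P) =
      (Fintype.card ι : ℝ≥0∞)⁻¹ * ∑ i, ∫⁻ x, (G i x : ℝ≥0∞) ∂P := by
  rw [lintegral_avgResample]
  congr 1
  refine Finset.sum_congr rfl fun i _ => ?_
  rw [lintegral_resample (q i) i P F.measurable_coe_ennreal_comp]
  refine lintegral_congr fun x => ?_
  rw [hG i x]
  rfl

/-- **The resampling-invariant coupling** («by compactness … converges by subsequences to a limit Q
… T Q = Q», the fixed point of (3.2.2.7)–(3.2.2.8)). For `OneSiteKernels μ μ' γ γ' q` on a compact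
metric spin space with FELLER one-site couplings `qᵢ`, there is a coupling `Q` of `μ` and `μ'` with
`T Q = Q`. [cite: Presutti2009, §3.2.2 proof of Thm. 3.2.2.1, (3.2.2.5)–(3.2.2.8)] -/
theorem exists_invariant_isCoupling [IsProbabilityMeasure μ] [IsProbabilityMeasure μ']
    [∀ i, IsMarkovKernel (γ i)] [∀ i, IsMarkovKernel (γ' i)] [∀ i, IsMarkovKernel (q i)]
    (h : OneSiteKernels μ μ' γ γ' q)
    (hq : ∀ i (g : (S × S) →ᵇ ℝ), Continuous fun x => ∫ s, g s ∂(q i x)) :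
    ∃ Q : Measure ((ι → S) × (ι → S)), IsProbabilityMeasure Q ∧ IsCoupling μ μ' Q ∧
      avgResample q Q = Q := by
  -- the product coupling as starting point
  let P₀ : ProbabilityMeasure ((ι → S) × (ι → S)) := ⟨μ.prod μ', inferInstance⟩
  have hP₀fst : (P₀ : Measure ((ι → S) × (ι → S))).map Prod.fst = μ := by
    show (μ.prod μ').map Prod.fst = μ
    rw [Measure.map_fst_prod, measure_univ, one_smul]
  have hP₀snd : (P₀ : Measure ((ι → S) × (ι → S))).map Prod.snd = μ' := by
    show (μ.prod μ').map Prod.snd = μ'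
    rw [Measure.map_snd_prod, measure_univ, one_smul]
  -- a weakly convergent subsequence of the Cesàro means
  obtain ⟨Q, -, φ, hφ, hlim⟩ :=
    (isCompact_univ (X := ProbabilityMeasure ((ι → S) × (ι → S)))).tendsto_subseq
      (x := cesaro q P₀) fun _ => Set.mem_univ _
  have hlim' := ProbabilityMeasure.tendsto_iff_forall_lintegral_tendsto.1 hlim
  refine ⟨Q, inferInstance, ⟨?_, ?_⟩, ?_⟩
  · -- first marginal of the limit
    refine ext_of_forall_lintegral_eq_of_IsFiniteMeasure fun f => ?_
    have hf : Measurable fun ω : ι → S => (f ω : ℝ≥0∞) :=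
      measurable_coe_nnreal_ennreal.comp f.continuous.measurable
    rw [lintegral_map hf measurable_fst]
    have h1 := hlim' (f.compContinuous ⟨Prod.fst, continuous_fst⟩)
    have h2 : ∀ k, ∫⁻ x, (f.compContinuous ⟨Prod.fst, continuous_fst⟩ x : ℝ≥0∞)
        ∂((cesaro q P₀ ∘ φ) k : Measure ((ι → S) × (ι → S))) = ∫⁻ ω, f ω ∂μ := fun k => by
      show ∫⁻ x, (f x.1 : ℝ≥0∞) ∂(cesaro q P₀ (φ k) : Measure ((ι → S) × (ι → S))) = _
      rw [← lintegral_map hf measurable_fst, map_fst_cesaro h hP₀fst]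
    simp_rw [h2] at h1
    exact tendsto_nhds_unique h1 tendsto_const_nhds
  · -- second marginal of the limit
    refine ext_of_forall_lintegral_eq_of_IsFiniteMeasure fun f => ?_
    have hf : Measurable fun ω : ι → S => (f ω : ℝ≥0∞) :=
      measurable_coe_nnreal_ennreal.comp f.continuous.measurable
    rw [lintegral_map hf measurable_snd]
    have h1 := hlim' (f.compContinuous ⟨Prod.snd, continuous_snd⟩)
    have h2 : ∀ k, ∫⁻ x, (f.compContinuous ⟨Prod.snd, continuous_snd⟩ x : ℝ≥0∞)
        ∂((cesaro q P₀ ∘ φ) k : Measure ((ι → S) × (ι → S))) = ∫⁻ ω, f ω ∂μ' := fun k => by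
      show ∫⁻ x, (f x.2 : ℝ≥0∞) ∂(cesaro q P₀ (φ k) : Measure ((ι → S) × (ι → S))) = _
      rw [← lintegral_map hf measurable_snd, map_snd_cesaro h hP₀snd]
    simp_rw [h2] at h1
    exact tendsto_nhds_unique h1 tendsto_const_nhds
  · -- invariance of the limit: `∫ F dTQ = ∫ F dQ` for every bounded continuous `F ≥ 0`
    refine ext_of_forall_lintegral_eq_of_IsFiniteMeasure fun F => ?_
    choose G hG using fun i => exists_bcf_lintegral_updatePair (q i) (hq i) i F
    have hT : ∀ (P : Measure ((ι → S) × (ι → S))) [IsProbabilityMeasure P],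
        ∫⁻ x, (F x : ℝ≥0∞) ∂(avgResample q P) =
          (Fintype.card ι : ℝ≥0∞)⁻¹ * ∑ i, ∫⁻ x, (G i x : ℝ≥0∞) ∂P := fun P _ =>
      lintegral_avgResample_eq_sum_lintegral F G hG P
    -- (1) `∫ F dT(Q_{φ k}) → ∫ F dT(Q)` by weak convergence applied to the `Gᵢ`
    have hTlim : Tendsto (fun k => ∫⁻ x, (F x : ℝ≥0∞)
        ∂(avgResample q ((cesaro q P₀ ∘ φ) k : Measure ((ι → S) × (ι → S))))) atTop
        (𝓝 (∫⁻ x, (F x : ℝ≥0∞) ∂(avgResample q (Q : Measure ((ι → S) × (ι → S)))))) := by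
      simp_rw [hT]
      refine ENNReal.Tendsto.const_mul (tendsto_finsetSum _ fun i _ => hlim' (G i))
        (Or.inr (ENNReal.inv_ne_top.2 (Nat.cast_ne_zero.2 Fintype.card_ne_zero)))
    -- (2) `∫ F dQ_{φ k} → ∫ F dQ`
    have hQlim := hlim' F
    -- (3) the two error terms `(φ k + 1)⁻¹ ∫ F dP₀`, `(φ k + 1)⁻¹ ∫ F dP_{φ k + 1}` tend to `0`
    have hbound : ∀ (ν : Measure ((ι → S) × (ι → S))) [IsProbabilityMeasure ν],
        ∫⁻ x, (F x : ℝ≥0∞) ∂ν ≤ edist 0 F := fun ν _ => by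
      simpa using F.lintegral_le_edist_mul ν
    have hinv0 : Tendsto (fun k => ((φ k + 1 : ℕ) : ℝ≥0∞)⁻¹) atTop (𝓝 0) :=
      ENNReal.tendsto_inv_nat_nhds_zero.comp ((tendsto_add_atTop_nat 1).comp hφ.tendsto_atTop)
    have herr : ∀ ν : ℕ → Measure ((ι → S) × (ι → S)), (∀ k, IsProbabilityMeasure (ν k)) →
        Tendsto (fun k => ((φ k + 1 : ℕ) : ℝ≥0∞)⁻¹ * ∫⁻ x, (F x : ℝ≥0∞) ∂(ν k)) atTop (𝓝 0) := by
      intro ν hν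
      have hup : Tendsto (fun k => ((φ k + 1 : ℕ) : ℝ≥0∞)⁻¹ * edist 0 F) atTop (𝓝 0) := by
        simpa using ENNReal.Tendsto.mul_const hinv0 (Or.inr (edist_ne_top _ _))
      exact tendsto_of_tendsto_of_tendsto_of_le_of_le tendsto_const_nhds hup (fun _ => bot_le)
        fun k => mul_le_mul' le_rfl (hbound (ν k))
    -- (4) pass to the limit in `∫F dT(Q_k) + (k+1)⁻¹∫F dP₀ = ∫F dQ_k + (k+1)⁻¹∫F dP_{k+1}`
    have hid : ∀ k, ∫⁻ x, (F x : ℝ≥0∞)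
        ∂(avgResample q ((cesaro q P₀ ∘ φ) k : Measure ((ι → S) × (ι → S)))) +
          ((φ k + 1 : ℕ) : ℝ≥0∞)⁻¹ * ∫⁻ x, (F x : ℝ≥0∞) ∂(P₀ : Measure ((ι → S) × (ι → S))) =
        ∫⁻ x, (F x : ℝ≥0∞) ∂((cesaro q P₀ ∘ φ) k : Measure ((ι → S) × (ι → S))) +
          ((φ k + 1 : ℕ) : ℝ≥0∞)⁻¹ *
            ∫⁻ x, (F x : ℝ≥0∞) ∂(orbit q P₀ (φ k + 1) : Measure ((ι → S) × (ι → S))) :=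
      fun k => lintegral_avgResample_cesaro_add q P₀ (φ k) _
    have hL := hTlim.add (herr (fun _ => (P₀ : Measure ((ι → S) × (ι → S)))) fun _ => inferInstance)
    have hR := hQlim.add (herr (fun k => (orbit q P₀ (φ k + 1) : Measure ((ι → S) × (ι → S))))
      fun _ => inferInstance)
    rw [add_zero] at hL hR
    simp only [Function.comp] at hid hL hR
    simp_rw [hid] at hL
    exact tendsto_nhds_unique hL hR

/-! ### Consequences of invariance: (3.2.2.8) as an identity, for every measurable cost -/

omit [MetricSpace S] [CompactSpace S] [BorelSpace S] in
/-- **(3.2.2.8) as an identity.** If `T Q = Q` then for every site `i` and every bounded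
measurable cost `c` on `S × S`: `∫ c(ωᵢ, ω'ᵢ) dQ = ∫ (∫ c dqᵢ(ω, ω')) dQ(ω, ω')` — «we fix `i ≠ j`
and sum over `ωᵢ, ω'ᵢ` … By (3.2.2.2) the last term is bounded …»; here with equality and no
condition on `c`. [cite: Presutti2009, §3.2.2 proof of Thm. 3.2.2.1, (3.2.2.8)] -/
theorem lintegral_coord_eq_of_invariant [∀ i, IsMarkovKernel (q i)]
    {Q : Measure ((ι → S) × (ι → S))} [IsProbabilityMeasure Q] (hQ : avgResample q Q = Q) (i : ι)
    {c : S × S → ℝ≥0∞} (hc : Measurable c) {C : ℝ≥0} (hcC : ∀ s, c s ≤ C) :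
    ∫⁻ x, c (x.1 i, x.2 i) ∂Q = ∫⁻ x, ∫⁻ s, c s ∂(q i x) ∂Q := by
  set A := ∫⁻ x, c (x.1 i, x.2 i) ∂Q with hA
  set B := ∫⁻ x, ∫⁻ s, c s ∂(q i x) ∂Q with hB
  have hci : Measurable fun x : (ι → S) × (ι → S) => c (x.1 i, x.2 i) :=
    hc.comp ((measurable_pi_apply i).comp measurable_fst |>.prodMk
      ((measurable_pi_apply i).comp measurable_snd))
  have hAfin : A ≠ ⊤ := by
    refine (lt_of_le_of_lt (lintegral_mono fun x => hcC _) ?_).ne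
    simp [ENNReal.coe_lt_top]
  -- `n·A = Σ_j ∫ c_i dT_j Q = (n−1)·A + B`
  have hsum : (Fintype.card ι : ℝ≥0∞) * A = ∑ j, ∫⁻ x, c (x.1 i, x.2 i) ∂(resample (q j) j Q) := by
    have h1 : A = ∫⁻ x, c (x.1 i, x.2 i) ∂(avgResample q Q) := by rw [hQ]
    rw [h1, lintegral_avgResample, ← mul_assoc,
      ENNReal.mul_inv_cancel (by exact_mod_cast Fintype.card_ne_zero) (ENNReal.natCast_ne_top _),
      one_mul]
  have hself : ∫⁻ x, c (x.1 i, x.2 i) ∂(resample (q i) i Q) = B := by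
    rw [hB, lintegral_resample (q i) i Q hci]
    refine lintegral_congr fun p => lintegral_congr fun t => ?_
    simp only [update_self]
  have hterm : ∀ j, ∫⁻ x, c (x.1 i, x.2 i) ∂(resample (q j) j Q) = if j = i then B else A := by
    intro j
    split_ifs with hji
    · rw [hji, hself]
    · exact lintegral_siteCost_resample_of_ne (q j) hji Q hc
  simp_rw [hterm] at hsum
  rw [Finset.sum_ite, Finset.filter_eq', if_pos (mem_univ i), sum_singleton, sum_const,
    nsmul_eq_mul] at hsum
  -- card of `univ.filter (· ≠ i)` is `n - 1`
  have hcard : ((univ.filter fun j => ¬j = i).card : ℝ≥0∞) = (Fintype.card ι : ℝ≥0∞) - 1 := by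
    rw [Finset.filter_ne' univ i, card_erase_of_mem (mem_univ i), card_univ,
      ENNReal.natCast_sub, Nat.cast_one]
  rw [hcard] at hsum
  -- `n A = B + (n-1) A` with `A < ∞` forces `A = B`
  have hn : (1 : ℝ≥0∞) ≤ Fintype.card ι := by exact_mod_cast Fintype.card_pos
  have hsplit : (Fintype.card ι : ℝ≥0∞) * A = A + ((Fintype.card ι : ℝ≥0∞) - 1) * A := by
    conv_lhs => rw [← tsub_add_cancel_of_le hn]
    rw [add_mul, one_mul, add_comm]
  rw [hsplit] at hsum
  have hfin : ((Fintype.card ι : ℝ≥0∞) - 1) * A ≠ ⊤ :=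
    ENNReal.mul_ne_top (ENNReal.sub_ne_top (ENNReal.natCast_ne_top _)) hAfin
  exact (ENNReal.add_left_inj hfin).1 hsum

/-- **Presutti 2009, Theorem 3.2.2.1, fixed-point form, for compact spins with Feller one-site
couplings**: ONE coupling `Q` of `μ`, `μ'` such that, for every site `i`, every bounded measurable
cost `cᵢ` on `S × S` and every measurable `Kᵢ` on pairs of configurations with
`∫ cᵢ dqᵢ(ω, ω') ≤ Kᵢ(ω, ω')` ((3.2.2.2)), `∫ cᵢ(ωᵢ, ω'ᵢ) dQ ≤ ∫ Kᵢ dQ` ((3.2.2.3)) — in particular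
for the discrete cost `𝟙{s ≠ s'}` (total-variation currency). [cite: Presutti2009, §3.2.2 Thm. 3.2.2.1] -/
theorem Presutti2009_thm_3_2_2_1_feller [IsProbabilityMeasure μ] [IsProbabilityMeasure μ']
    [∀ i, IsMarkovKernel (γ i)] [∀ i, IsMarkovKernel (γ' i)] [∀ i, IsMarkovKernel (q i)]
    (h : OneSiteKernels μ μ' γ γ' q)
    (hq : ∀ i (g : (S × S) →ᵇ ℝ), Continuous fun x => ∫ s, g s ∂(q i x)) :
    ∃ Q : Measure ((ι → S) × (ι → S)), IsProbabilityMeasure Q ∧ IsCoupling μ μ' Q ∧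
      avgResample q Q = Q ∧
      ∀ i {c : S × S → ℝ≥0∞}, Measurable c → ∀ {C : ℝ≥0}, (∀ s, c s ≤ C) →
        ∀ {K : (ι → S) × (ι → S) → ℝ≥0∞}, (∀ p, ∫⁻ s, c s ∂(q i p) ≤ K p) →
          ∫⁻ x, c (x.1 i, x.2 i) ∂Q ≤ ∫⁻ x, K x ∂Q := by
  obtain ⟨Q, hQ, hcpl, hinv⟩ := exists_invariant_isCoupling h hq
  refine ⟨Q, hQ, hcpl, hinv, fun i c hc C hcC K hK => ?_⟩
  rw [lintegral_coord_eq_of_invariant hinv i hc hcC]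
  exact lintegral_mono fun p => hK p

/-- **Corollary 3.2.2.2, fixed-point form**: with bounded measurable costs `dⱼ ≤ Cⱼ` and one-site
bounds `∫ dᵢ dqᵢ(ω, ω') ≤ cᵢ + Σ_{j ≠ i} r_{ij} dⱼ(ωⱼ, ω'ⱼ) + χᵢ(ω) + χ'ᵢ(ω')` (measurable cut-offs
`χᵢ, χ'ᵢ`), the invariant coupling has `vᵢ ≤ cᵢ + Σ_{j ≠ i} r_{ij} vⱼ + ∫ χᵢ dμ + ∫ χ'ᵢ dμ'`.
No continuity of `d`, `χ` is needed. [cite: Presutti2009, §3.2.2 Cor. 3.2.2.2 with §11.5.6 (11.5.6.7)–(11.5.6.8)] -/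
theorem Presutti2009_cor_3_2_2_2_feller [IsProbabilityMeasure μ] [IsProbabilityMeasure μ']
    [∀ i, IsMarkovKernel (γ i)] [∀ i, IsMarkovKernel (γ' i)] [∀ i, IsMarkovKernel (q i)]
    (h : OneSiteKernels μ μ' γ γ' q)
    (hq : ∀ i (g : (S × S) →ᵇ ℝ), Continuous fun x => ∫ s, g s ∂(q i x))
    (d : ι → S × S → ℝ≥0∞) (hd : ∀ i, Measurable (d i)) (Cd : ι → ℝ≥0)
    (hdC : ∀ i s, d i s ≤ Cd i) (c : ι → ℝ≥0∞) (r : ι → ι → ℝ≥0∞)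
    (χ χ' : ι → (ι → S) → ℝ≥0∞) (hχ : ∀ i, Measurable (χ i)) (hχ' : ∀ i, Measurable (χ' i))
    (hK : ∀ i p, ∫⁻ s, d i s ∂(q i p) ≤
      c i + ∑ j ∈ univ.erase i, r i j * d j (p.1 j, p.2 j) + χ i p.1 + χ' i p.2) :
    ∃ Q : Measure ((ι → S) × (ι → S)), IsProbabilityMeasure Q ∧ IsCoupling μ μ' Q ∧
      avgResample q Q = Q ∧
      ∀ i, ∫⁻ x, d i (x.1 i, x.2 i) ∂Q ≤
        c i + ∑ j ∈ univ.erase i, r i j * ∫⁻ x, d j (x.1 j, x.2 j) ∂Q +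
          ∫⁻ ω, χ i ω ∂μ + ∫⁻ ω', χ' i ω' ∂μ' := by
  obtain ⟨Q, hQ, hcpl, hinv, hle⟩ := Presutti2009_thm_3_2_2_1_feller h hq
  refine ⟨Q, hQ, hcpl, hinv, fun i => ?_⟩
  have hdj : ∀ j, Measurable fun x : (ι → S) × (ι → S) => d j (x.1 j, x.2 j) := fun j =>
    (hd j).comp ((measurable_pi_apply j).comp measurable_fst |>.prodMk
      ((measurable_pi_apply j).comp measurable_snd))
  have hm1 : Measurable fun x : (ι → S) × (ι → S) => χ i x.1 := (hχ i).comp measurable_fst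
  have hm2 : Measurable fun x : (ι → S) × (ι → S) => χ' i x.2 := (hχ' i).comp measurable_snd
  have hms : Measurable fun x : (ι → S) × (ι → S) => ∑ j ∈ univ.erase i, r i j * d j (x.1 j, x.2 j) :=
    Finset.measurable_sum _ fun j _ => (hdj j).const_mul _
  refine (hle i (hd i) (hdC i) (hK i)).trans (le_of_eq ?_)
  rw [lintegral_add_right _ hm2, lintegral_add_right _ hm1,
    lintegral_add_left measurable_const, lintegral_const, measure_univ, mul_one,
    lintegral_finsetSum _ fun j _ => (hdj j).const_mul _]
  simp_rw [lintegral_const_mul _ (hdj _)]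
  have h1 : ∫⁻ x, χ i x.1 ∂Q = ∫⁻ ω, χ i ω ∂μ := by
    rw [← hcpl.1, lintegral_map (hχ i) measurable_fst]
  have h2 : ∫⁻ x, χ' i x.2 ∂Q = ∫⁻ ω', χ' i ω' ∂μ' := by
    rw [← hcpl.2, lintegral_map (hχ' i) measurable_snd]
  rw [h1, h2]

end Main



end DobrushinCouplingInvariant

end Literature.Probability.TransportMaps

end
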